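import Summits.Langlands.Langlands.Theses.FifteenLocusEisenstein
import Summits.Langlands.Langlands.Theses.SkinnerWilesDefectOne

/-!
# Birth skeleton (BC3) of the crux `ReducibleOrdinaryModular` (stmt-Langlands-12918),
# route `FifteenLocusEisenstein` — line `birth`: Skinner–Wiles' own seam,
# ENGINE (pro-modularity at defect one) → EXIT (ordinary classicality) → X

`ReducibleOrdinaryModular` (rank 4 in `FifteenLocusEisenstein`, where it is the IMPORTED ENGINE of
the oriented-ordinary case (i); the same item is the rank-0 TARGET X of route `SkinnerWilesDefectOne`
and a rank-4 crux of `EvenSkinnerWilesMirror` — one shared item, three routes, one decl text):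
over an imaginary quadratic `F`, `p ≠ 2`, `O` = the valuation ring of `ℚ̄_p`, every irreducible,
a.e.-unramified `ρ : Γ_F → GL₂(ℚ̄_p)` with a residually upper-triangular integral model `ρ₀`,
`p`-distinguished and Skinner–Wiles-ORIENTED ordinary of ONE parallel weight `k ≥ 2` (exponent `m`)
at every `v ∣ p`, is weakly modular: for every level witness `hcpt` and every `ι : ℚ̄_p ≃ ℂ` there is
an L-algebraic cuspidal `π` on `GL₂(𝔸_F)` with `SatakeFrobCompatibleAt ι π ρ v` for cofinitely many
`v` (Skinner–Wiles 1999 Theorem A transposed to Taylor–Wiles defect `l₀ = 1`).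

The line cuts the crux along SKINNER–WILES' OWN SEAM (Publ. IHÉS 89 (1999) §4: "ρ is pro-modular"
(Main Theorem, §§4.1–4.4) THEN "pro-modular + ordinary of parallel weight ⇒ modular" (Prop. 3.7 /
Hida control)), which is exactly how the parent route `SkinnerWilesDefectOne` decomposes its target
and how the programme staffs it:

  X = ReducibleOrdinaryModular
    ⇐ (STUB 1, THE ENGINE — open, staffed as crux stmt-Langlands-12919 `ReducibleOrdinaryProModular`
       of `SkinnerWilesDefectOne`, rank 2 there; its crux directory carries a standing `Disproof.lean`
       (cdisprove verdict NO KILL), registered lines `steinberg_hyperplane`, `fine_selmer_codimension_two`,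
       `siegel_wall_skinner_wiles`, `generic_eisenstein_rigidity` (dead) and a STRATEGY-CENSUS):
       same binders and hypotheses as X minus `(hcpt, ι)`; conclusion: `ρ` is `p`-ADICALLY AUTOMORPHIC
       of SOME tame level — `∃ 𝒰 : BigHeckeGLn.TameLevel 2 F p, 𝒰.IsPadicallyAutomorphic ρ` (a
       continuous `ℚ̄_p`-point of the completed-cohomology Hecke algebra `𝕋(𝒰)` of the Bianchi tower
       whose Hecke–Frobenius polynomials are `charpoly ρ(Frob_v)` off `𝒰.bad`). Mechanism foreseen by
       the parent: `R_𝒟 = ` nearly ordinary deformation ring of the oriented residual extension over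
       `Λ_F = 𝒪⟦T₁,T₂,Y₁,Y₂⟧`, reducible locus of dimension `≤ 3` versus components of dimension
       `≥ 4 = dim Λ_F − l₀`, nice primes made pro-modular from ONE Eisenstein seed, the `Λ`-adic
       reducible strata pinned by an auxiliary Taylor–Steinberg place instead of base change;
    ∘ (STUB 2, THE EXIT — open, staffed as crux stmt-Langlands-12921 `ProModularOrdinaryClassical`
       of `SkinnerWilesDefectOne`, rank 4 there; crux directory with `Disproof.lean`, `Split.lean`,
       lines `top_degree_exact_control`, `ordinary-patching-by-regime` (dead), `paskunas-centre-split`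
       (dead), `exit_split`, and a landed Negative file `SlotZeroWeight`): for `F` imaginary
       quadratic, `p` odd, every irreducible a.e.-unramified `ρ` that is `p`-adically automorphic of
       some tame level AND ordinary of one parallel weight `k ≥ 2` at every `v ∣ p`
       (`IsOrdinaryOfWeightAt`, NO orientation, NO residual hypothesis) is classically automorphic:
       `∃` L-algebraic cuspidal `π` with cofinite `SatakeFrobCompatibleAt ι π ρ`. Mechanism foreseen:
       Galois-ordinary ⇒ the `𝕋(𝒰)`-point factors through Hida's nearly ordinary part (the open core:
       Emerton's ordinary factorisation is `GL₂(ℚ_p)`-only), Hida control for `GL₂/F` in degrees 1–2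
       (Hida 1993/94; Khare–Thorne 2017 top-degree exactness; Borel–Serre finiteness = the PROVED item
       `BianchiCongruenceCohomologyFinite`), Eichler–Shimura–Harder to an L-algebraic cuspidal `π`.

The composition `ReducibleOrdinaryModular_of` is eight lines of logic over the item signatures —
under X's binders the engine gives `𝒰` with `𝒰.IsPadicallyAutomorphic ρ`; X's local clause at
`v ∣ p`, with `IsPDistinguishedAt` and the orientation inequality `‖Q₀₀‖ ≤ ‖Q₁₀‖` dropped, is
repackaged as `ρ.IsOrdinaryOfWeightAt p v k m` by the Literature lemma
`FramedGaloisRep.isOrdinaryOfWeightAt_iff_padicAlgCl` (.mpr); the exit then yields `π` — i.e. the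
body of `SkinnerWilesDefectOne.closes` without its `SectorComplement` step, equivalently the PROVED
support item `SkinnerWilesDefectOne.ModularOfProModularClassical` (stmt-Langlands-14468,
`Theorems/SkinnerWilesDefectOneModularOfProModularClassical.lean`), re-run here so that it concludes
the `FifteenLocusEisenstein` copy of the decl BY NAME (the two copies are the same term:
`crux_iff_parent` below is `Iff.rfl`). Kernel-checked, no `sorry` outside the two stubs.

Neither stub is the crux or the summit reworded (BC3 / `line.shredded` check; probes recorded in
`Lines/birth.md` and in the registrar's NOTES): STUB 1 concludes only WEAK `p`-adic automorphy — no
`π`, no `ι`, no `hcpt`, no classicality — and classicality of ordinary `p`-adically automorphic `ρ`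
of regular parallel weight over an imaginary quadratic field is itself open (the exit), so STUB 1
does not give X cheaply; STUB 2 ASSUMES `p`-adic automorphy, which for a residually REDUCIBLE `ρ`
is precisely what Skinner–Wiles propagation must supply (no residually reducible automorphy lifting
at positive defect is in print: Skinner–Wiles / Pan / X. Zhang are totally real, Berger–Klosin /
Akers minimal with one-dimensional Selmer group, Caraiani–Newton residually irreducible), so STUB 2
does not give X cheaply either; and neither mentions `ReciprocityData`, `Corresponds` or any `n ≠ 2`,
so neither gives `Langlands`. Both stubs are (much) more than M-sized: each is a staffed crux with
its own lines. This is deliberate for an IMPORTED-ENGINE crux: the birth skeleton of X in this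
route must be the seam along which X is actually being attacked, so that "a plan for both pieces"
(BC2 (d)) is literally the two existing crux directories.

## Contents

* `stub_proModularEngine : SkinnerWilesDefectOne.ReducibleOrdinaryProModular` (STUB 1 — the staffed
  engine item stmt-Langlands-12919, stated BY NAME: the registered audit `#h21_check_skeleton` admits
  hypotheses of the skeleton theorem only as registered obligations by name, and the item's decl IS the
  registered obligation; its full text is the `def` in the imported parent route file, l. 643–644),
  `stub_ordinaryClassicalExit : SkinnerWilesDefectOne.ProModularOrdinaryClassical` (STUB 2 — the
  staffed exit item stmt-Langlands-12921, l. 683–684) — `sorry` ONLY in these two;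
* `ReducibleOrdinaryModular_of` — STUB 1 → STUB 2 → the crux BY NAME
  (`Summit.Langlands.Langlands.Theses.FifteenLocusEisenstein.ReducibleOrdinaryModular`), eight lines,
  no `sorry` (axioms propext / Classical.choice / Quot.sound); `ReducibleOrdinaryModular_proof` — the
  crux modulo exactly the two stubs;
* `ReducibleOrdinaryModular_of_parent` / `ReducibleOrdinaryModular_proof_parent` — the same two
  theorems concluding the PARENT's copy `SkinnerWilesDefectOne.ReducibleOrdinaryModular` (the item's
  primary decl, which `ledger skeleton check` targets by default), via the `Iff.rfl` certificate
  `crux_iff_parent`; so the file registers under either decl of the shared item, and closing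
  stmt-Langlands-12919 + stmt-Langlands-12921 closes stmt-Langlands-12918 for all three routes at once.

Disproof used: this crux has no `Disproof.lean` of its own (`ledger crux ls stmt-Langlands-12918`:
"(no workfiles yet)" at registration, 2026-08-17); inherited from the pieces — ENGINE
`Cruxes/ReducibleOrdinaryProModular/Disproof.lean` (verdict NO KILL; its `withoutAEUnramified_iff` /
landed `Theorems.ReducibleOrdinaryProModular.Negative.LevelAndRamification`
(`ae_isUnramifiedAt_of_isPadicallyAutomorphic`, `not_isPadicallyAutomorphic_full`,
`bad_of_not_isUnramifiedAt`) say a.e.-unramifiedness is NECESSARY and the tame level must stay FREE —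
STUB 1 keeps `hunr` and concludes `∃ 𝒰` with free `bad`, verbatim the vetted item, so it is not an
instance those lemmas refute; the orientation clause is kept verbatim (`exists_orientedFrame`,
`not_oriented_of_lowerLeft_eq_zero`: non-vacuous and restrictive)); EXIT
`Cruxes/ProModularOrdinaryClassical/Disproof.lean` + landed `Negative/SlotZeroWeight` refute the
naive slot-zero diamond-weight STRENGTHENING of an internal stub of the exit's line, not the exit
as stated — STUB 2 is the item verbatim (refuter-checked, grounded). `ledger negatives --problem
Langlands`: no entry equal or trivially equivalent to either stub (both are OPEN vetted items).

Regime caution (refuter route-review on the item, 2026-08-16, ROUTE-REVIEW.md O1–O5): should the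
ENGINE item ever be RESTATED with a regime hypothesis (the fine-Selmer regime `r₀ ≤ 2`, which
contains the `T₅(11a1)|Γ_{ℚ(√−2)}` witness), `ReducibleOrdinaryModular_of` would no longer reach X
from the restated engine; this skeleton is then to be RE-CUT as engine-in-regime → large-rank
complement → exit (three stubs), not patched. Today (route rev 3, commit ba9923a1ebab; parent rev
with `closes` native OK) the engine item is unrestated and STUB 1 is its verbatim text.

Imports: the route file (`Statement` + `OrdinaryGaloisRep`) and the parent route file
`SkinnerWilesDefectOne` (adds `CompletedCohomologyHeckeAlgebraGLn`, needed anyway for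
`BigHeckeGLn.TameLevel` / `IsPadicallyAutomorphic`; no Theorems file is imported, so no landed proof
is silently available to the stubs).
-/

set_option linter.dupNamespace false

namespace Summit.Langlands.Langlands.Cruxes.ReducibleOrdinaryModular.Birth

open Filter
open Summit.Langlands.Langlands.Theses.FifteenLocusEisenstein (ReducibleOrdinaryModular)

/-! ### §0 Certificate: this route's copy of the crux IS the parent's target (same term) -/

/-- The shared item stmt-Langlands-12918 rendered in `FifteenLocusEisenstein` and in
`SkinnerWilesDefectOne` is one and the same proposition (definitional). [certificate] -/
theorem crux_iff_parent :
    ReducibleOrdinaryModular ↔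
      Summit.Langlands.Langlands.Theses.SkinnerWilesDefectOne.ReducibleOrdinaryModular :=
  Iff.rfl

/-! ### §1 The two stubs (the ONLY `sorry`s of this file) -/

/-- STUB 1 — THE ENGINE (Skinner–Wiles Main Theorem at defect one; = the staffed crux item
stmt-Langlands-12919 of route `SkinnerWilesDefectOne`, by name). Statement (parent route file,
`def ReducibleOrdinaryProModular`): for `F` imaginary quadratic (`IsTotallyComplex`, `finrank ℚ F = 2`),
`p ≠ 2`, `O` = the valuation ring of `ℚ̄_p`, every `ρ : FramedGaloisRep F (PadicAlgCl p) 2` that is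
irreducible, a.e. unramified, has a residually upper-triangular integral model `ρ₀` over `O`
(`HasUpperTriangularIntegralModel`), and for ONE parallel weight `k ≥ 2` and exponent `m > 0` is, at
every `v ∣ p`, `p`-distinguished (`IsPDistinguishedAt ρ₀ v`) and SW-ORIENTED ordinary (a frame `Q`
with `‖Q₀₀‖ ≤ ‖Q₁₀‖`, lower-left of `Q⁻¹ρ|_{D_v}Q` zero, `θ₂^m = 1` and `θ₁^m = ε^{(k-1)m}` on inertia),
is `p`-ADICALLY AUTOMORPHIC of SOME tame level: `∃ 𝒰 : BigHeckeGLn.TameLevel 2 F p,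
𝒰.IsPadicallyAutomorphic ρ` (a continuous `ℚ̄_p`-point of the completed-cohomology Hecke algebra of the
Bianchi tower with Hecke–Frobenius polynomials `charpoly ρ(Frob_v)` off `𝒰.bad`; level and depth
free). Why plausibly true: the `GL₂`/imaginary-quadratic residually-reducible-ordinary sector of the
pro-modularity expectation (big `R = 𝕋`, Gee–Newton 2022 conditional; Skinner–Wiles 1999 at `l₀ = 0`);
the parent's foreseen mechanism: nearly ordinary deformation ring over `Λ_F = 𝒪⟦T₁,T₂,Y₁,Y₂⟧`,
reducible locus of dimension `≤ 3` vs components of dimension `≥ 4 = dim Λ_F − l₀`, nice primes made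
pro-modular from ONE Eisenstein seed, `Λ`-adic reducible strata pinned by an auxiliary
Taylor–Steinberg place (landed `SteinbergHyperplane.tame_relation_pin`). Size XL / open; its own crux
directory `Cruxes/ReducibleOrdinaryProModular/` holds the standing Disproof (NO KILL) and the lines. -/
theorem stub_proModularEngine :
    Summit.Langlands.Langlands.Theses.SkinnerWilesDefectOne.ReducibleOrdinaryProModular := by
  sorry

/-- STUB 2 — THE EXIT (Skinner–Wiles Prop. 3.7 / Hida control at defect one; = the staffed crux item
stmt-Langlands-12921 of route `SkinnerWilesDefectOne`, by name). Statement (parent route file,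
`def ProModularOrdinaryClassical`): for `F` imaginary quadratic, `p ≠ 2`, every level witness `hcpt`
and `ι : ℚ̄_p ≃ ℂ`, every `ρ : FramedGaloisRep F (PadicAlgCl p) 2` that is irreducible, a.e. unramified,
`p`-adically automorphic of some tame level (`∃ 𝒰, 𝒰.IsPadicallyAutomorphic ρ`) and ordinary of ONE
parallel weight `k ≥ 2` with exponent `m > 0` at every `v ∣ p` (`ρ.IsOrdinaryOfWeightAt p v k m` — NO
orientation, NO residual hypothesis) is classically automorphic: `∃ π : CuspidalAutomorphicRepData 2 F
hcpt`, L-algebraic, with `SatakeFrobCompatibleAt ι π ρ v` for cofinitely many `v`. Why plausibly true: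
classicality of ordinary `p`-adic automorphic forms of regular parallel weight — Hida control for
`GL₂/F` in degrees 1–2 (Hida 1993/1994), Khare–Thorne 2017 top-degree exactness, Borel–Serre finiteness
(= the PROVED item `BianchiCongruenceCohomologyFinite`), Eichler–Shimura–Harder; the open core is the
ordinary factorisation of the `𝕋(𝒰)`-point (Galois-ordinary ⇒ Hecke-ordinary) off `F_v = ℚ_p`. Size
L–XL / open; its own crux directory `Cruxes/ProModularOrdinaryClassical/` holds Disproof, Split and
lines. -/
theorem stub_ordinaryClassicalExit :
    Summit.Langlands.Langlands.Theses.SkinnerWilesDefectOne.ProModularOrdinaryClassical := by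
  sorry

/-! ### §2 The composition: STUB 1 → STUB 2 → the crux BY NAME (no `sorry`) -/

/-- ENGINE → EXIT → `FifteenLocusEisenstein.ReducibleOrdinaryModular` (the crux of THIS route, BY
NAME). Under X's binders the engine gives a tame level `𝒰` with `𝒰.IsPadicallyAutomorphic ρ`; X's
local clause at `v ∣ p`, with `IsPDistinguishedAt` and the orientation inequality dropped, is
`ρ.IsOrdinaryOfWeightAt p v k m` by `FramedGaloisRep.isOrdinaryOfWeightAt_iff_padicAlgCl` (.mpr); the
exit gives `π`. (The body of `SkinnerWilesDefectOne.closes` without its `SectorComplement` step; = the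
PROVED support item `ModularOfProModularClassical`, re-run against this route's copy of the decl.) -/
theorem ReducibleOrdinaryModular_of
    (h₁ : Summit.Langlands.Langlands.Theses.SkinnerWilesDefectOne.ReducibleOrdinaryProModular)
    (h₂ : Summit.Langlands.Langlands.Theses.SkinnerWilesDefectOne.ProModularOrdinaryClassical) :
    Summit.Langlands.Langlands.Theses.FifteenLocusEisenstein.ReducibleOrdinaryModular := by
  intro F _ _ hF hdeg p _ hp O hO hcpt ι ρ ρ₀ hirr hunr hmod hloc
  refine h₂ F hF hdeg p hp hcpt ι ρ hirr hunr (h₁ F hF hdeg p hp O hO ρ ρ₀ hirr hunr hmod hloc) ?_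
  obtain ⟨k, hk, m, hm, hv⟩ := hloc
  refine ⟨k, hk, m, hm, fun v hpv => ?_⟩
  obtain ⟨-, Q, -, hQ⟩ := hv v hpv
  exact (Literature.NumberTheory.GaloisRepresentations.FramedGaloisRep.isOrdinaryOfWeightAt_iff_padicAlgCl
    p ρ v k m).mpr ⟨Q, hQ⟩

/-- The crux of THIS route modulo exactly the two stubs (skeleton theorem; `sorry` only via the stubs). -/
theorem ReducibleOrdinaryModular_proof :
    Summit.Langlands.Langlands.Theses.FifteenLocusEisenstein.ReducibleOrdinaryModular :=
  ReducibleOrdinaryModular_of stub_proModularEngine stub_ordinaryClassicalExit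

/-! ### §3 The same skeleton against the PARENT's copy of the shared decl (default target of
`ledger skeleton check --crux stmt-Langlands-12918`) -/

/-- ENGINE → EXIT → `SkinnerWilesDefectOne.ReducibleOrdinaryModular` (the item's primary decl, BY
NAME), through `crux_iff_parent`. No `sorry`. -/
theorem ReducibleOrdinaryModular_of_parent
    (h₁ : Summit.Langlands.Langlands.Theses.SkinnerWilesDefectOne.ReducibleOrdinaryProModular)
    (h₂ : Summit.Langlands.Langlands.Theses.SkinnerWilesDefectOne.ProModularOrdinaryClassical) :
    Summit.Langlands.Langlands.Theses.SkinnerWilesDefectOne.ReducibleOrdinaryModular :=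
  crux_iff_parent.mp (ReducibleOrdinaryModular_of h₁ h₂)

/-- The parent's copy of the crux modulo exactly the two stubs. -/
theorem ReducibleOrdinaryModular_proof_parent :
    Summit.Langlands.Langlands.Theses.SkinnerWilesDefectOne.ReducibleOrdinaryModular :=
  ReducibleOrdinaryModular_of_parent stub_proModularEngine stub_ordinaryClassicalExit

end Summit.Langlands.Langlands.Cruxes.ReducibleOrdinaryModular.Birth
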